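import Literature.AlgebraicTopology.SingularHomology.SingularChainsConcrete
import Literature.AlgebraicTopology.SingularHomology.ChainSubcomplex
import Literature.AlgebraicTopology.SingularHomology.ExcisionMayerVietoris
import HarnessLib

/-!
# Singular homology has compact supports (Hatcher Prop. 3.33, increasing open unions)

Trunk T-ALGTOP (singular homology). Let `W₀ ⊆ W₁ ⊆ ⋯` be an increasing sequence of open subsets
of a space `X` with union `V = ⋃ₘ Wₘ`. Since a singular chain is a finite sum of simplices, each
with compact image, every chain of `V` is a chain of some `Wₘ` (`CChain.exists_carrier_subset`);
consequently (A. Hatcher, *Algebraic Topology*, CUP 2002, Prop. 3.33: `Hₙ(V) = colim Hₙ(Wₘ)`,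
and the compactness remark in the proof of Prop. 2B.1)

* `Literature.AlgebraicTopology.SingularHomology.singularHomology.exists_map_eq_zero_of_iUnion` (**injectivity half**): a class of
  `Hᵢ(W₀; M)` which dies in `Hᵢ(V; M)` already dies in some `Hᵢ(Wₘ; M)`;
* `Literature.AlgebraicTopology.SingularHomology.singularHomology.exists_eq_map_of_iUnion` (**surjectivity half**): every class of
  `Hᵢ(V; M)` is the image of a class of some `Hᵢ(Wₘ; M)`.

Both are proved for Mathlib's singular homology `Literature.singularHomology R M` (arbitrary
coefficients) by passing to the concrete chain model `Literature.AlgebraicTopology.SingularHomology.csingularChainComplex` of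
`SingularChainsConcrete.lean` (`csingularHomology.compIso`) and arguing with carriers of chains
(`Literature.AlgebraicTopology.SingularHomology.CChain.carrier`, compact) and the identification of the chains of a subspace `A` with the
chains of `X` carried by `A` (`Literature.AlgebraicTopology.SingularHomology.mapDomain_val_injective`, `Literature.AlgebraicTopology.SingularHomology.range_lmapDomain_val`); homology
classes are handled through `Literature.AlgebraicTopology.SingularHomology.homologyCls` of `ChainSubcomplex.lean`.

## Main statements

* `Literature.AlgebraicTopology.SingularHomology.CChain.exists_carrier_subset`: a chain of `X` carried by `⋃ₘ Wₘ` is carried by some `Wₘ`.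
* `Literature.AlgebraicTopology.SingularHomology.csingularHomology.exists_map_eq_zero_of_iUnion`,
  `Literature.AlgebraicTopology.SingularHomology.csingularHomology.exists_eq_map_of_iUnion`: the two halves for concrete singular homology.
* `Literature.AlgebraicTopology.SingularHomology.singularHomology.exists_map_eq_zero_of_iUnion`,
  `Literature.AlgebraicTopology.SingularHomology.singularHomology.exists_eq_map_of_iUnion`: the two halves for `Literature.AlgebraicTopology.SingularHomology.singularHomology`.

## References

* A. Hatcher, *Algebraic Topology*, CUP 2002, §2.1 (chains have compact image), Prop. 2B.1
  (proof), Prop. 3.33 [HatcherAT2002].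

## Design notes

* The union is passed as a named set `V` with `hV : ⋃ m, W m = V`, so that users can supply the
  union in the syntactic form they have; all maps are induced by inclusions of subsets
  (`Literature.AlgebraicTopology.SingularHomology.subsetInclusion`, `Literature.AlgebraicTopology.SingularHomology.subsetIncl` of `ExcisionMayerVietoris.lean`).
* Boundaries live in degree `(ComplexShape.down ℕ).prev i` (propositionally `i + 1`); the
  argument never needs this identification.
* No declaration in this file uses `sorry`.
-/

noncomputable section

open CategoryTheory Limits Set Function

universe u v

namespace Literature.AlgebraicTopology.SingularHomology

variable (R : Type v) [CommRing R] (M : Type v) [AddCommGroup M] [Module R M]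
variable {X : Type u} [TopologicalSpace X]

/-! ### Carriers of chains in an increasing open union -/

/-- A chain carried by the union of an increasing sequence of open sets is carried by one of
them: its carrier is compact (Hatcher 2002, §2.1; proof of Prop. 2B.1, "compact image").
[cite: HatcherAT2002, Prop. 2B.1 (proof)] -/
theorem CChain.exists_carrier_subset {n : ℕ} (W : ℕ → Set X) (hWo : ∀ m, IsOpen (W m))
    (hWm : Monotone W) (c : CChain M X n) (hc : CChain.carrier c ⊆ ⋃ m, W m) :
    ∃ m, CChain.carrier c ⊆ W m :=
  (CChain.isCompact_carrier c).elim_directed_cover W hWo hc hWm.directed_le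

namespace csingularChainComplex

variable {R M}

/-- The chain map induced by a continuous map commutes with the differentials, elementwise.
[folklore] -/
theorem d_map_f_apply {Y : Type u} [TopologicalSpace Y] (f : C(X, Y)) (i j : ℕ)
    (x : (csingularChainComplex R M X).X i) :
    (csingularChainComplex R M Y).d i j ((map R M f).f i x) =
      (map R M f).f j ((csingularChainComplex R M X).d i j x) := by
  rw [← ModuleCat.comp_apply, (map R M f).comm i j, ModuleCat.comp_apply]

/-- `f♯ ≫ g♯ = (g ∘ f)♯` on chains, elementwise. [folklore] -/
theorem map_f_map_f_apply {Y Z : Type u} [TopologicalSpace Y] [TopologicalSpace Z] (f : C(X, Y))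
    (g : C(Y, Z)) (i : ℕ) (x : (csingularChainComplex R M X).X i) :
    (map R M g).f i ((map R M f).f i x) = (map R M (g.comp f)).f i x := by
  rw [map_comp, HomologicalComplex.comp_f, ModuleCat.comp_apply]

/-- The chains of `X` in the image of `Cₙ(↥A) → Cₙ(X)` are those carried by `A`: a chain of `X`
with carrier in `A` lifts to `A` (Hatcher 2002, §2.1). [folklore] -/
theorem exists_map_val_eq_of_carrier_subset {A : Set X} {n : ℕ} (c : CChain M X n)
    (hc : CChain.carrier c ⊆ A) :
    ∃ c' : (csingularChainComplex R M ↥A).X n, (map R M (subsetIncl A)).f n c' = c := by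
  have hmem : c ∈ chainsIn R M X A n := (CChain.mem_chainsIn_iff_carrier_subset R c).2 hc
  rw [← range_lmapDomain_val] at hmem
  obtain ⟨c', hc'⟩ := hmem
  exact ⟨c', hc'⟩

/-- A chain pushed forward from a subspace `A` is carried by `A`. [folklore] -/
theorem carrier_map_val_subset (A : Set X) {n : ℕ} (c : (csingularChainComplex R M ↥A).X n) :
    CChain.carrier ((map R M (subsetIncl A)).f n c) ⊆ A := by
  rw [← CChain.mem_chainsIn_iff_carrier_subset R, ← range_lmapDomain_val]
  exact ⟨c, rfl⟩

/-- `Cₙ(↥A) → Cₙ(X)` is injective. [folklore] -/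
theorem map_val_f_injective (A : Set X) (n : ℕ) :
    Injective ((map R M (subsetIncl A)).f n) :=
  mapDomain_val_injective (M := M) A n

end csingularChainComplex

/-! ### The two halves for concrete singular homology -/

namespace csingularHomology

variable {R M}

/-- **Compact supports, injectivity half (concrete chains).** For an increasing sequence of open
sets `Wₘ` with union `V`, a class of `Hᵢ(W₀; M)` vanishing in `Hᵢ(V; M)` vanishes in some
`Hᵢ(Wₘ; M)` (Hatcher 2002, Prop. 3.33 and proof of Prop. 2B.1). [cite: HatcherAT2002, Prop. 3.33] -/
theorem exists_map_eq_zero_of_iUnion (W : ℕ → Set X) (hWo : ∀ m, IsOpen (W m))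
    (hWm : Monotone W) {V : Set X} (hV : ⋃ m, W m = V) (i : ℕ)
    (γ : csingularHomology R M ↥(W 0) i)
    (hγ : csingularHomology.map R M (subsetInclusion (hV ▸ subset_iUnion W 0 : W 0 ⊆ V)) i γ
      = 0) :
    ∃ m, csingularHomology.map R M (subsetInclusion (hWm (Nat.zero_le m))) i γ = 0 := by
  subst hV
  -- represent `γ` by a cycle `z`; its image in `⋃ W` bounds a chain `β`
  obtain ⟨z, hz, rfl⟩ := homologyCls_surjective γ
  rw [csingularHomology.map, homologyMap_homologyCls, homologyCls_eq_zero_iff] at hγ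
  obtain ⟨β, hβ⟩ := hγ
  -- push `β` into `X`; it is carried by some `W m`
  set βX := (csingularChainComplex.map R M (subsetIncl (⋃ m, W m))).f _ β with hβX
  obtain ⟨m, hm⟩ := CChain.exists_carrier_subset M W hWo hWm βX
    (csingularChainComplex.carrier_map_val_subset _ β)
  obtain ⟨βm, hβm⟩ := csingularChainComplex.exists_map_val_eq_of_carrier_subset (R := R) βX hm
  refine ⟨m, ?_⟩
  rw [csingularHomology.map, homologyMap_homologyCls, homologyCls_eq_zero_iff]
  refine ⟨βm, csingularChainComplex.map_val_f_injective (W m) i ?_⟩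
  -- both sides push forward to `∂ βX = (val₀)♯ z` in `X`
  have h1 : (subsetIncl (⋃ m, W m)).comp (subsetInclusion (subset_iUnion W 0)) =
      subsetIncl (W 0) := by
    ext x
    rfl
  have h2 : (subsetIncl (W m)).comp (subsetInclusion (hWm (Nat.zero_le m))) = subsetIncl (W 0) := by
    ext x
    rfl
  rw [← csingularChainComplex.d_map_f_apply, hβm, hβX, csingularChainComplex.d_map_f_apply, hβ,
    csingularChainComplex.map_f_map_f_apply, csingularChainComplex.map_f_map_f_apply, h1, h2]

/-- **Compact supports, surjectivity half (concrete chains).** For an increasing sequence of open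
sets `Wₘ` with union `V`, every class of `Hᵢ(V; M)` comes from some `Hᵢ(Wₘ; M)`
(Hatcher 2002, Prop. 3.33). [cite: HatcherAT2002, Prop. 3.33] -/
theorem exists_eq_map_of_iUnion (W : ℕ → Set X) (hWo : ∀ m, IsOpen (W m)) (hWm : Monotone W)
    {V : Set X} (hV : ⋃ m, W m = V) (i : ℕ) (γ : csingularHomology R M ↥V i) :
    ∃ (m : ℕ) (γ' : csingularHomology R M ↥(W m) i),
      csingularHomology.map R M (subsetInclusion (hV ▸ subset_iUnion W m : W m ⊆ V)) i γ' = γ := by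
  subst hV
  obtain ⟨z, hz, rfl⟩ := homologyCls_surjective γ
  set zX := (csingularChainComplex.map R M (subsetIncl (⋃ m, W m))).f i z with hzX
  obtain ⟨m, hm⟩ := CChain.exists_carrier_subset M W hWo hWm zX
    (csingularChainComplex.carrier_map_val_subset _ z)
  obtain ⟨zm, hzm⟩ := csingularChainComplex.exists_map_val_eq_of_carrier_subset (R := R) zX hm
  have h2 : (subsetIncl (⋃ m, W m)).comp (subsetInclusion (subset_iUnion W m)) =
      subsetIncl (W m) := by
    ext x
    rfl
  -- `zm` maps to `z`
  have hzmz : (csingularChainComplex.map R M (subsetInclusion (subset_iUnion W m))).f i zm = z := by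
    apply csingularChainComplex.map_val_f_injective (⋃ m, W m) i
    rw [csingularChainComplex.map_f_map_f_apply, h2, hzm, hzX]
  -- `zm` is a cycle
  have hzm0 : (csingularChainComplex R M ↥(W m)).d i ((ComplexShape.down ℕ).next i) zm = 0 := by
    apply csingularChainComplex.map_val_f_injective (W m)
    rw [← csingularChainComplex.d_map_f_apply, hzm, hzX, csingularChainComplex.d_map_f_apply, hz,
      map_zero, map_zero]
  refine ⟨m, homologyCls zm hzm0, ?_⟩
  rw [csingularHomology.map, homologyMap_homologyCls]
  exact homologyCls_congr hzmz _ _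

end csingularHomology

/-! ### The two halves for `Literature.AlgebraicTopology.SingularHomology.singularHomology` -/

namespace singularHomology

variable {R M}

/-- **Singular homology has compact supports, injectivity half.** Let `W₀ ⊆ W₁ ⊆ ⋯` be open
subsets of `X` with union `V`. A class `γ ∈ Hᵢ(W₀; M)` whose image in `Hᵢ(V; M)` vanishes has
vanishing image in `Hᵢ(Wₘ; M)` for some `m` (Hatcher, *Algebraic Topology*, Prop. 3.33:
`Hᵢ(V) = colim Hᵢ(Wₘ)`; the compactness remark in the proof of Prop. 2B.1).
[cite: HatcherAT2002, Prop. 3.33] -/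
theorem exists_map_eq_zero_of_iUnion (W : ℕ → Set X) (hWo : ∀ m, IsOpen (W m))
    (hWm : Monotone W) {V : Set X} (hV : ⋃ m, W m = V) (i : ℕ)
    (γ : singularHomology R M ↥(W 0) i)
    (hγ : singularHomology.map R M (subsetInclusion (hV ▸ subset_iUnion W 0 : W 0 ⊆ V)) i γ = 0) :
    ∃ m, singularHomology.map R M (subsetInclusion (hWm (Nat.zero_le m))) i γ = 0 := by
  have key := csingularHomology.exists_map_eq_zero_of_iUnion W hWo hWm hV i
    ((csingularHomology.compIso R M ↥(W 0) i).inv γ) (by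
      rw [csingularHomology.map_eq_conj, ModuleCat.comp_apply, ModuleCat.comp_apply,
        Iso.inv_hom_id_apply, hγ, map_zero])
  obtain ⟨m, hm⟩ := key
  refine ⟨m, ?_⟩
  rw [← (csingularHomology.compIso R M ↥(W 0) i).inv_hom_id_apply γ, ← ModuleCat.comp_apply,
    ← csingularHomology.map_comp_compIso_hom, ModuleCat.comp_apply, hm, map_zero]

/-- **Singular homology has compact supports, surjectivity half.** Let `W₀ ⊆ W₁ ⊆ ⋯` be open
subsets of `X` with union `V`. Every class of `Hᵢ(V; M)` is the image of a class of `Hᵢ(Wₘ; M)`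
for some `m` (Hatcher, *Algebraic Topology*, Prop. 3.33). [cite: HatcherAT2002, Prop. 3.33] -/
theorem exists_eq_map_of_iUnion (W : ℕ → Set X) (hWo : ∀ m, IsOpen (W m)) (hWm : Monotone W)
    {V : Set X} (hV : ⋃ m, W m = V) (i : ℕ) (γ : singularHomology R M ↥V i) :
    ∃ (m : ℕ) (γ' : singularHomology R M ↥(W m) i),
      singularHomology.map R M (subsetInclusion (hV ▸ subset_iUnion W m : W m ⊆ V)) i γ' = γ := by
  obtain ⟨m, γ', h⟩ := csingularHomology.exists_eq_map_of_iUnion W hWo hWm hV i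
    ((csingularHomology.compIso R M ↥V i).inv γ)
  refine ⟨m, (csingularHomology.compIso R M ↥(W m) i).hom γ', ?_⟩
  rw [← ModuleCat.comp_apply, ← csingularHomology.map_comp_compIso_hom, ModuleCat.comp_apply, h,
    Iso.inv_hom_id_apply]

end singularHomology

end Literature.AlgebraicTopology.SingularHomology
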